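import Literature.IUT.HodgeArakelov.TemperedThetaMonoids
import HarnessLib

/-!
# [IUTchII] Prop. 3.1 (i)–(ii): the interface predicate `Prop31Statements E` is a SCHEMA — universal-closure certificate (proof-only)

S. Mochizuki, *Inter-universal Teichmüller theory II*, kurims manuscript (Dec. 2020), §3, Proposition 3.1 (i)–(ii) pp. 87–88
[claim: Mochizuki2012, status: disputed] (IUTchII §3 Prop 3.1, kurims pp.87-88).  abc-iut cell, D-0079 L-K «cone below S,
unconditional», K-L6 slice (abc-iut-w4-d007 gen 10, row «KL6-CLOSURE-CERTS»; lineage: the [IUTchII] Prop 3.1 (ii) constant-monoid /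
Kummer package G-w4d019-1).  PROOF-ONLY companion of abc-iut-L6-t2's `TemperedThetaMonoids.lean` (no `def`, no `instance`, nothing
re-typed).

The frozen FACT-LIST row **F-2567** `TemperedThetaMonoids.Prop31Statements` occurs in HYPOTHESIS position inside the typed statement
of the L6 cone row IUTchIII:Thm2.2(ii) (abc-iut-w5-d012 `L6-SLICE-INPUT-CENSUS-v2`, ca24e4516e42b12c; label `conditional`).  It is a
`Prop`-valued structure on an ARBITRARY `E : ThetaEnvData P` — an interface record (ambient module `H`, conjugation action
`conj : P →* Aut H`, unit group, constant monoid `Ψ_cns = M_TM`, theta subsets) whose only axiom is `units_eq` («`M^×_TM` is the group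
of units of `M_TM`»).  Nothing ties `conj` to `M_TM`, so clause (ii) «`Ψ_cns(M^Θ_*)` is stable under the conjugation action» can
fail: take `H = ℤ` (written multiplicatively), `P = Aut(H)` acting tautologically, `M_TM = ℕ ⊆ ℤ` (so `M^×_TM = 0`, as `units_eq`
demands) — the inversion `x ↦ x⁻¹ ∈ P` moves `1 ∈ ℕ` to `−1 ∉ ℕ`.  Hence the universal closure of F-2567 is FALSE
(`not_forall_prop31Statements`) and the row is consumable only in instance form at the genuine mono-theta data, where the tree holds
`prop31Statements_of_kummer` / `prop31Statements_of_val` (abc-iut-w4-d019 / L6-d3: clause (ii) from an EQUIVARIANT Kummer map onto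
`M_TM`, clause (i) from a valuation), the model discharge `EtaleLevels.prop31ii_thetaEnvRecordKummer_of_cyclotomeTower` (this lineage)
and the non-degenerate witness `prop31Statements_witness` (FACT-LIST class «universal-closure REFUTED / schema; instance forms …»).

HONEST FRAMING: a refuted universal closure is a statement about OUR typing (the record admits inhabitants whose action ignores the
constant monoid), not about the printed proposition, where `Π_X(M^Θ_*)` acts on `Ψ_cns(M^Θ_*) ≅ 𝒪^▷_{F̄_v}` through the Galois action;
nothing here bears on [IUTchIII] Cor. 3.12 or takes a side; typed ≠ proved; nothing asserts abc proved or refuted.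
-/

namespace Literature.IUT.HodgeArakelov

namespace TemperedThetaMonoids

/-- **IUTchII:Prop3.1(ii)** (kurims p.88) A degenerate inhabitant of the interface `ThetaEnvData` violating clause (ii) of
`Prop31Statements` («`Ψ_cns` is stable under the conjugation action»): `H = ℤ` (multiplicative notation), `P = Aut(H)` acting
tautologically, `M_TM =` the non-negative powers of the generator, `M^×_TM = 1`, no theta classes; the inversion moves the generator
out of `M_TM`. [claim: Mochizuki2012, status: disputed] (IUTchII §3 Prop 3.1 (ii), kurims p.88) -/
theorem exists_thetaEnvData_not_prop31Statements :
    ∃ E : ThetaEnvData.{0, 0} (MulAut (Multiplicative ℤ)), ¬ Prop31Statements E := by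
  let g : Multiplicative ℤ := Multiplicative.ofAdd 1
  -- `x ∈ ℕ·g` iff `x = g ^ n`
  have hpow : ∀ n : ℕ, g ^ n = Multiplicative.ofAdd (n : ℤ) := fun n => by
    rw [← ofAdd_nsmul, nsmul_one]
  let E : ThetaEnvData.{0, 0} (MulAut (Multiplicative ℤ)) :=
    { H := CommGrpCat.of (Multiplicative ℤ)
      conj := MonoidHom.id _
      Iota := PUnit
      units := ⊥
      constants := Submonoid.powers g
      units_eq := by
        intro x
        constructor
        · intro hx
          rw [Subgroup.mem_bot] at hx
          subst hx
          rw [inv_one]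
          exact ⟨Submonoid.one_mem _, Submonoid.one_mem _⟩
        · rintro ⟨hx1, hx2⟩
          obtain ⟨m, hm⟩ := (Submonoid.mem_powers_iff _ _).mp hx1
          obtain ⟨n, hn⟩ := (Submonoid.mem_powers_iff _ _).mp hx2
          rw [hpow] at hm hn
          rw [Subgroup.mem_bot]
          have hmn : Multiplicative.ofAdd ((m : ℤ) + n) = 1 := by
            rw [ofAdd_add, hm, hn, mul_inv_cancel]
          have h0 : (m : ℤ) + n = 0 := by simpa using congrArg Multiplicative.toAdd hmn
          have hm0 : (m : ℤ) = 0 := by omega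
          rw [← hm, hm0]
          rfl
      thetaEnv := fun _ => ∅
      inftyThetaEnv := fun _ => ∅
      theta_subset := fun _ => Set.Subset.rfl }
  refine ⟨E, fun h => ?_⟩
  -- the inversion `x ↦ x⁻¹` of `ℤ` lies in `P = Aut(H)` and moves `g ∈ M_TM` to `g⁻¹ ∉ M_TM`
  have hg : (g : E.H) ∈ E.constantMonoid := ⟨1, pow_one g⟩
  have key := h.constants_stable (MulEquiv.inv (Multiplicative ℤ)) g hg
  change (MulEquiv.inv (Multiplicative ℤ)) g ∈ Submonoid.powers g at key
  rw [MulEquiv.inv_apply] at key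
  obtain ⟨n, hn⟩ := (Submonoid.mem_powers_iff _ _).mp key
  rw [hpow] at hn
  have hn' : (n : ℤ) = -1 := by
    have := congrArg Multiplicative.toAdd hn
    simp [g] at this
  omega

/-- **F-2567 is a schema**: the universal closure of `Prop31Statements` (over all groups `P` and all `E : ThetaEnvData P`) is
FALSE; the instance forms the cone uses are `prop31Statements_of_kummer` / `prop31Statements_of_val` (and the model discharge
`EtaleLevels.prop31ii_thetaEnvRecordKummer_of_cyclotomeTower`). [claim: Mochizuki2012, status: disputed] (IUTchII §3 Prop 3.1, kurims pp.87-88) -/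
theorem not_forall_prop31Statements :
    ¬ ∀ (P : Type) [Group P] (E : ThetaEnvData.{0, 0} P), Prop31Statements E := fun h => by
  obtain ⟨E, hE⟩ := exists_thetaEnvData_not_prop31Statements
  exact hE (h _ E)

end TemperedThetaMonoids

end Literature.IUT.HodgeArakelov
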